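import Mathlib
import Summits.Ventures.FusionMHD.Models.CerfonFreidbergIterLikeQHalfGradBoxes
import HarnessLib

/-!
# Ventures/FusionMHD — Models/CerfonFreidbergIterLikeQHalfGradBoxes1.lean: KERNEL CHECK of the per-panel `∂_s G` boxes of panels 0–15 (of 32)
# at `ψ_N = 1/2` of THE Cerfon–Freidberg ITER-like instance

HONEST FRAMING (LADDER-GRIDFUSION three columns; CF rung; «F2.R2-CF-MERCIER-IMPLICIT» step (4)).  Sixteen `decide +kernel`s (natural interval extension of
the code list `GsS` over `gBox k`, ≈ 3 s each as separate theorems — a single bounded-`∀` decide of the same sixteen costs minutes): `|∂_s G| ≤ MGP k` on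
each box.  MODELLED: analytic Cerfon–Freidberg family; nothing about a device or stability.  No `native_decide`.  Typer/prover: gridfusion-model-7 (g7),
2026-08-27.  Citations: Moore 1979 §4.3 (4.21) [Moore1979].
-/

namespace Summit.Ventures.FusionMHD.Models.CFIterLike.QHalf

/-- **KERNEL CHECK** of the `∂_s G` box of panel 0. -/
theorem gsok1_0 : gsok1 0 = true := by decide +kernel

/-- **KERNEL CHECK** of the `∂_s G` box of panel 1. -/
theorem gsok1_1 : gsok1 1 = true := by decide +kernel

/-- **KERNEL CHECK** of the `∂_s G` box of panel 2. -/
theorem gsok1_2 : gsok1 2 = true := by decide +kernel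

/-- **KERNEL CHECK** of the `∂_s G` box of panel 3. -/
theorem gsok1_3 : gsok1 3 = true := by decide +kernel

/-- **KERNEL CHECK** of the `∂_s G` box of panel 4. -/
theorem gsok1_4 : gsok1 4 = true := by decide +kernel

/-- **KERNEL CHECK** of the `∂_s G` box of panel 5. -/
theorem gsok1_5 : gsok1 5 = true := by decide +kernel

/-- **KERNEL CHECK** of the `∂_s G` box of panel 6. -/
theorem gsok1_6 : gsok1 6 = true := by decide +kernel

/-- **KERNEL CHECK** of the `∂_s G` box of panel 7. -/
theorem gsok1_7 : gsok1 7 = true := by decide +kernel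

/-- **KERNEL CHECK** of the `∂_s G` box of panel 8. -/
theorem gsok1_8 : gsok1 8 = true := by decide +kernel

/-- **KERNEL CHECK** of the `∂_s G` box of panel 9. -/
theorem gsok1_9 : gsok1 9 = true := by decide +kernel

/-- **KERNEL CHECK** of the `∂_s G` box of panel 10. -/
theorem gsok1_10 : gsok1 10 = true := by decide +kernel

/-- **KERNEL CHECK** of the `∂_s G` box of panel 11. -/
theorem gsok1_11 : gsok1 11 = true := by decide +kernel

/-- **KERNEL CHECK** of the `∂_s G` box of panel 12. -/
theorem gsok1_12 : gsok1 12 = true := by decide +kernel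

/-- **KERNEL CHECK** of the `∂_s G` box of panel 13. -/
theorem gsok1_13 : gsok1 13 = true := by decide +kernel

/-- **KERNEL CHECK** of the `∂_s G` box of panel 14. -/
theorem gsok1_14 : gsok1 14 = true := by decide +kernel

/-- **KERNEL CHECK** of the `∂_s G` box of panel 15. -/
theorem gsok1_15 : gsok1 15 = true := by decide +kernel

end Summit.Ventures.FusionMHD.Models.CFIterLike.QHalf
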